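import Literature.MathematicalPhysics.QuantumFieldTheory.Balaban1983to89.B9Eq315QTowerLipschitzTwoBackgrounds
import Literature.MathematicalPhysics.QuantumFieldTheory.Balaban1983to89.B9Thm311SmallFieldCoercivityTower

/-!
# `Balaban1983to89.B9Eq368RLipschitzTowerTwoBackgrounds` — T. Bałaban, *Propagators for lattice gauge theories in a background field*, Commun.
# Math. Phys. **99** (1985) 389–434 [Balaban1985BackgroundPropagators] (3.68) p. 403 ∕ (3.76) p. 405 with (3.21)–(3.25) p. 394: AT `k` LEVELS
# AND A FIXED LATTICE THE PROJECTION `R(U)` ONTO `Δ_U N(Q′_k(U))` IS LIPSCHITZ IN THE BACKGROUND BETWEEN TWO GENERAL SMALL BACKGROUNDS —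
# `‖R_k(U)z − R_k(U′)z‖ ≤ C_R·δ·‖z‖` for two backgrounds of the finest torus `T_{L^k m}` whose bond variables AND level averages are `U1`-valued,
# `ε`-small (`ε ≤ ε_R`) and `δ`-close: the one-step (Q3a)₂ `B9Eq368RLipschitzTwoBackgrounds` (this lineage, gen 73) ONE STOREY UP, on the
# flat tower modulus of `B9Thm311SmallFieldCoercivityTower`, the tower right inverse of `B9Eq319QprimeTowerCentre` and the `k`-level
# two-background `Q′_k` letter of `B9Eq315QTowerLipschitzTwoBackgrounds`

statement-level skeleton of published theorems with citation tags; proofs where landed; nothing here is a claim about the Yang–Mills mass gap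

PDF held: `paper:balaban1985-cmp99-background-propagators` (journal page = PDF page + 388); pp. 394, 403, 405–406 through the verbatim quotations of
`B9Eq368RLipschitz` (NE9 owner gen 81), whose proof this file runs between two backgrounds at `k` levels.

CITATION HEADER (lean-in-tree rule 2026-08-18).  Audit cell `pub-balaban`, sub-cell `t4`, NE9 crux team (2): LEAF PROVER 04
(`b2b-balaban-t4-ne9-formalise-leaf-04` gen 74) — TOWER-SPECIES-PLAN §2 (e) (the two-background chain one storey up), the first JUNCTION above the
`k`-level two-background averaging letter `ρ′_k(U,U′)` (this lineage's `B9Eq315QTowerLipschitzTwoBackgrounds`, gen 74).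

THE PRINT (as quoted in `B9Eq368RLipschitz`).  (3.21) p. 394: `R(U)` the orthogonal projection onto `Δ_U N(Q′_k(U))`, (3.24)–(3.25): `Q′_k(U)` the
composite averaging of the gauge parameters with `(Q′G′²Q′*)⁻¹`; p. 403: *«the operators R(U), P(U) = I − R(U) extend … and satisfy the same bounds»*;
pp. 405–406, (3.76): *«= DRD* − V₂(A) − P₁(A). (3.76)»* at a GENERAL `U` and its perturbation `U′U`; p. 407: *«The operator P₁(A) … is a non-local
bounded operator and satisfies the bound (3.77)»*.  Print's `Q′` IS the `k`-level composite; the one-step files were the case `k = 1`.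

WHAT IS PROVED (sorry-free; no `Prop` placeholder; no inequality of the paper asserted).
* **`exists_RofUk_sub_RofUk_linear`** — `∃ C_R ε_R > 0` such that for every pair `U`, `U′` on `T_{L^{n+1} m}` whose bond variables and whose level
  averages `Ū^j(b)`, `Ū′^j(b)` (`B9Eq315QTower.UlevOf`, DISPLAYED letters) lie in `U1`, are `ε`-close to `1` (`ε ≤ ε_R`) and `δ`-close to each other,
  with mutually adjoint finest transporters (`hRS`, `hRS′`): `‖R_k(U)z − R_k(U′)z‖ ≤ C_R·δ·‖z‖` for the tower letter `B9Eq326OperatorTower.RofUk`.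
  MECHANISM (= (Q3a)₂ verbatim one storey up): (1) the flat injectivity modulus `μ` of `Δ^η_1` on `N(Q′_k(1))`
  (`B9Thm311SmallFieldCoercivityTower.exists_flat_modulus_tower`, a compactness witness) transported to `Δ^η_{U′}` on `N(Q′_k(U′))` by
  `B9Eq368ProjectionRemainder.modulus_perturbed` (`≥ μ∕2` for `ε ≤ ε_R`); (2) the two one-sided gaps of `norm_projR_sub_projR_le` between
  `(Δ_{U′}, Q′_k(U′))` and `(Δ_U, Q′_k(U))` with the letters `εΔ = 4(1+ε_R)|η|⁻²d·δ_R` ((B)₂ on the finest lattice) and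
  `ρ = C_S·C_ρ·δ_R`, `C_ρ = (n+1)·d(L−1)·2^{d(L−1)(n+2)}·c₀^{−1∕2}` (the `k`-level letters `norm_QprimeTowerW_sub_flat_le` ∕
  `norm_QprimeTowerW_sub_QprimeTowerW_le` + the tower right inverse `exists_QprimeTowerW_rightInverse`, `C_S = (L^d)^{n+1}√(c₀·#T_m)`), `δ_R = 2M_φM_φ′·min(δ, 2ε)`.
MODEL / HONEST SCOPE.  [folklore] finite-dimensional bookkeeping at a FIXED lattice and number of levels (`C_R, ε_R` depend on `L, m, n, η, c₀, M_φ, M_φ′`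
and on the non-explicit compactness modulus `μ`); both backgrounds in the small-bond ball TOGETHER WITH their level averages (the smallness is the
owner's `B7Eq43AveragedSmallness`, the closeness this lineage's `B7Eq65AverageLipschitz`, the `U1`-membership an averaging-closed subgroup — all
DISPLAYED here); NOT print's analytic `P₁(A)`, NOT uniformity in the volume or in `k`; a junction letter of a two-general-backgrounds `k`-level chart,
NOT that chart, NOT NE9; NOT summit progress (cell pub-balaban: NE9 NOT PRINTED ∕ NOT PROVED; spine PROVED 0∕9; rung (B)+1 finite T⁴ — NOT infinite
volume, NOT mass gap, NOT Clay).  NEW file importing `B9Eq315QTowerLipschitzTwoBackgrounds`, `B9Thm311SmallFieldCoercivityTower`; nothing of the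
NE9-owner ∕ leaf-02 ∕ leaf-03 lineages' files is modified.  Net new unproved facts: 0.
-/

noncomputable section

open scoped InnerProductSpace ComplexConjugate

namespace Literature.MathematicalPhysics.QuantumFieldTheory.Balaban1983to89.B9Eq368RLipschitzTowerTwoBackgrounds

open B4Sect5Torus (TSite)
open B9SectCLatticeCarrier (Bond)
open B7Prop1Explicit (U1)
open B9Eq311L2Pairing (WL2)
open B9Eq319QprimeTorus (fineP)
open B11Eq103H1Complex (SiteL2K BondL2K covLaplaceSiteK RLatticeK)
open B9Eq310HessianOperator (adTransportW adTransportW_apply)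
open B9Eq315QTower (towerP UlevOf)
open B9Eq326OperatorTower (RofUk QprimeTowerW)
open B9Eq368ProjectionRemainder (norm_projR_sub_projR_le modulus_perturbed)
open B9Eq373DerivativeRemainderL2 (norm_covLaplaceSiteK_sub_le norm_covLaplaceSiteK_le)
open B9Eq373DerivativeRemainderTwoBackgrounds (norm_covLaplaceSiteK_sub_le₂)
open B9Eq384RemainderLetters (adTransportW_one_apply adTransportW_one_inv_apply hRS_one norm_adTransportW_sub_le)
open B9Thm311SmallFieldCoercivityTower (exists_flat_modulus_tower)
open B9Eq319QprimeTowerCentre (exists_QprimeTowerW_rightInverse)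
open B9Eq315QTowerLipschitz (norm_QprimeTowerW_sub_flat_le)
open B9Eq315QTowerLipschitzTwoBackgrounds (norm_QprimeTowerW_sub_QprimeTowerW_le)
open B9Eq368RLipschitzTwoBackgrounds (norm_adTransportW_sub_adTransportW_le)

/-- arithmetic helper: `B·t ≤ μ/2` when `t ≤ μ/(2B + 1)`. [folklore] -/
private theorem mul_le_half_of_le_div {B μ t : ℝ} (hB : 0 ≤ B) (hμ : 0 ≤ μ) (ht : t ≤ μ / (2 * B + 1)) : B * t ≤ μ / 2 := by
  have h1 : B * t ≤ B * (μ / (2 * B + 1)) := mul_le_mul_of_nonneg_left ht hB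
  have h2 : B * (μ / (2 * B + 1)) ≤ μ / 2 := by
    rw [mul_div_assoc', div_le_div_iff₀ (by positivity) (by norm_num)]; nlinarith
  exact h1.trans h2

/-- STEP-1 BUDGET (pure real arithmetic, kept out of the main proof's context): with `ε_R = K_R·ε ≤ 1` and
`(1 + C_ρK_R)ε ≤ μ∕(2B₁ + 1)`, the perturbed modulus `μ(1 − ρ₁) − (εΔ₁ + Mρ₁)` of `Δ_{U′}` on `N(Q′(U′))` is at least `μ∕2`. [folklore] -/
private theorem budget₁ {μ p d KR Cρ CS ε : ℝ} (hμ : 0 < μ) (hp : 0 ≤ p) (hd : 0 ≤ d) (hKR : 0 ≤ KR) (hCρ : 0 ≤ Cρ) (hCS : 0 ≤ CS)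
    (hε : 0 ≤ ε) (ht1 : ε ≤ 1 / (KR + 1)) (ht2 : (1 + Cρ * KR) * ε ≤ μ / (2 * (μ * CS + 6 * (p * d) * KR + 16 * (p * d) * CS) + 1)) :
    KR * ε ≤ 1 ∧ 0 ≤ 4 * (1 + KR * ε) ^ 2 * p * d ∧
    μ / 2 ≤ μ * (1 - CS * (Cρ * (KR * ε))) -
      (2 * (2 + KR * ε) * p * d * (KR * ε) + 4 * (1 + KR * ε) ^ 2 * p * d * (CS * (Cρ * (KR * ε)))) := by
  have hn : 0 ≤ p * d := mul_nonneg hp hd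
  have hKε1 : KR * ε ≤ 1 := by
    refine (mul_le_mul_of_nonneg_left ht1 hKR).trans ?_
    rw [mul_one_div, div_le_one (by positivity)]; linarith
  refine ⟨hKε1, by positivity, ?_⟩
  set B₁ : ℝ := μ * CS + 6 * (p * d) * KR + 16 * (p * d) * CS with hB₁def
  have hB₁ : 0 ≤ B₁ := by positivity
  set t : ℝ := (1 + Cρ * KR) * ε with htdef
  have hεt : ε ≤ t := by rw [htdef]; nlinarith [mul_nonneg (mul_nonneg hCρ hKR) hε]
  have hεRt : KR * ε ≤ KR * t := mul_le_mul_of_nonneg_left hεt hKR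
  have hρt : CS * (Cρ * (KR * ε)) ≤ CS * t := by rw [htdef]; refine mul_le_mul_of_nonneg_left ?_ hCS; nlinarith
  have hρ0 : 0 ≤ CS * (Cρ * (KR * ε)) := by positivity
  have hM16 : 4 * (1 + KR * ε) ^ 2 * p * d ≤ 16 * (p * d) := by
    have h1 : (1 + KR * ε) ^ 2 ≤ 4 := by
      calc (1 + KR * ε) ^ 2 ≤ 2 ^ 2 := pow_le_pow_left₀ (by positivity) (by linarith) 2
        _ = 4 := by norm_num
    calc 4 * (1 + KR * ε) ^ 2 * p * d = (1 + KR * ε) ^ 2 * (4 * (p * d)) := by ring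
      _ ≤ 4 * (4 * (p * d)) := mul_le_mul_of_nonneg_right h1 (by positivity)
      _ = 16 * (p * d) := by ring
  have hεΔ1 : 2 * (2 + KR * ε) * p * d * (KR * ε) ≤ 6 * (p * d) * KR * t := by
    have h1 : 2 * (2 + KR * ε) ≤ 6 := by linarith
    calc 2 * (2 + KR * ε) * p * d * (KR * ε) = (2 * (2 + KR * ε)) * ((p * d) * (KR * ε)) := by ring
      _ ≤ 6 * ((p * d) * (KR * t)) := mul_le_mul h1 (mul_le_mul_of_nonneg_left hεRt hn) (by positivity) (by norm_num)
      _ = 6 * (p * d) * KR * t := by ring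
  have hMρ1 : 4 * (1 + KR * ε) ^ 2 * p * d * (CS * (Cρ * (KR * ε))) ≤ 16 * (p * d) * CS * t :=
    calc 4 * (1 + KR * ε) ^ 2 * p * d * (CS * (Cρ * (KR * ε))) ≤ 16 * (p * d) * (CS * (Cρ * (KR * ε))) :=
          mul_le_mul_of_nonneg_right hM16 hρ0
      _ ≤ 16 * (p * d) * (CS * t) := mul_le_mul_of_nonneg_left hρt (by positivity)
      _ = 16 * (p * d) * CS * t := by ring
  have hμρ1 : μ * (CS * (Cρ * (KR * ε))) ≤ μ * CS * t := by rw [mul_assoc μ CS t]; exact mul_le_mul_of_nonneg_left hρt hμ.le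
  have hB₁t : B₁ * t ≤ μ / 2 := mul_le_half_of_le_div hB₁ hμ.le ht2
  have : μ * CS * t + (6 * (p * d) * KR * t + 16 * (p * d) * CS * t) = B₁ * t := by rw [hB₁def]; ring
  nlinarith [hμρ1, hεΔ1, hMρ1, hB₁t, this]

/-- STEP-2 BUDGET (pure real arithmetic): with `δ₀ ≤ 2ε` and `ε ≤ (μ∕2)∕(2B₂ + 1)`, the modulus of the second perturbation stays `≥ μ∕4`
and the gap constant is `≤ 64·n·K_R(1 + 2C_SC_ρ)∕μ · δ₀`. [folklore] -/
private theorem budget₂ {μ p d KR Cρ CS ε δ₀ εΔ₂ : ℝ} (hμ : 0 < μ) (hp : 0 ≤ p) (hd : 0 ≤ d) (hKR : 0 ≤ KR) (hCρ : 0 ≤ Cρ) (hCS : 0 ≤ CS)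
    (hε : 0 ≤ ε) (hδ₀ : 0 ≤ δ₀) (hδ₀ε : δ₀ ≤ 2 * ε) (hKε1 : KR * ε ≤ 1) (hεΔ₂ : εΔ₂ = 4 * (1 + KR * ε) * p * d * (KR * δ₀))
    (ht3 : ε ≤ μ / 2 / (2 * (μ * CS * Cρ * KR + 16 * (p * d) * KR + 32 * (p * d) * CS * Cρ * KR) + 1)) :
    0 ≤ εΔ₂ ∧ 0 ≤ 64 * (p * d) * KR * (1 + 2 * CS * Cρ) / μ ∧
    μ / 4 ≤ μ / 2 * (1 - CS * (Cρ * (KR * δ₀))) - (εΔ₂ + 4 * (1 + KR * ε) ^ 2 * p * d * (CS * (Cρ * (KR * δ₀)))) ∧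
    2 * (εΔ₂ + 4 * (1 + KR * ε) ^ 2 * p * d * (CS * (Cρ * (KR * δ₀)))) /
        (μ / 2 * (1 - CS * (Cρ * (KR * δ₀))) - (εΔ₂ + 4 * (1 + KR * ε) ^ 2 * p * d * (CS * (Cρ * (KR * δ₀))))) ≤
      64 * (p * d) * KR * (1 + 2 * CS * Cρ) / μ * δ₀ := by
  have hn : 0 ≤ p * d := mul_nonneg hp hd
  have hKε0 : 0 ≤ KR * ε := by positivity
  have hεΔ₂0 : 0 ≤ εΔ₂ := by rw [hεΔ₂]; positivity
  refine ⟨hεΔ₂0, by positivity, ?_⟩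
  set ρ₂ : ℝ := CS * (Cρ * (KR * δ₀)) with hρ₂def
  have hρ₂0 : 0 ≤ ρ₂ := by positivity
  set B₂ : ℝ := μ * CS * Cρ * KR + 16 * (p * d) * KR + 32 * (p * d) * CS * Cρ * KR with hB₂def
  have hB₂ : 0 ≤ B₂ := by positivity
  have hM16 : 4 * (1 + KR * ε) ^ 2 * p * d ≤ 16 * (p * d) := by
    have h1 : (1 + KR * ε) ^ 2 ≤ 4 := by
      calc (1 + KR * ε) ^ 2 ≤ 2 ^ 2 := pow_le_pow_left₀ (by positivity) (by linarith) 2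
        _ = 4 := by norm_num
    calc 4 * (1 + KR * ε) ^ 2 * p * d = (1 + KR * ε) ^ 2 * (4 * (p * d)) := by ring
      _ ≤ 4 * (4 * (p * d)) := mul_le_mul_of_nonneg_right h1 (by positivity)
      _ = 16 * (p * d) := by ring
  have hδ₀t : KR * δ₀ ≤ 2 * (KR * ε) := by
    have := mul_le_mul_of_nonneg_left hδ₀ε hKR; linarith
  have hρ₂t : ρ₂ ≤ 2 * CS * Cρ * KR * ε := by
    rw [hρ₂def]
    calc CS * (Cρ * (KR * δ₀)) = (CS * Cρ) * (KR * δ₀) := by ring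
      _ ≤ (CS * Cρ) * (2 * (KR * ε)) := mul_le_mul_of_nonneg_left hδ₀t (mul_nonneg hCS hCρ)
      _ = 2 * CS * Cρ * KR * ε := by ring
  have hεΔ₂t : εΔ₂ ≤ 16 * (p * d) * KR * ε := by
    have h1 : 4 * (1 + KR * ε) ≤ 8 := by linarith
    rw [hεΔ₂]
    calc 4 * (1 + KR * ε) * p * d * (KR * δ₀) = (4 * (1 + KR * ε)) * ((p * d) * (KR * δ₀)) := by ring
      _ ≤ 8 * ((p * d) * (2 * (KR * ε))) := mul_le_mul h1 (mul_le_mul_of_nonneg_left hδ₀t hn) (by positivity) (by norm_num)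
      _ = 16 * (p * d) * KR * ε := by ring
  have hMρ2 : 4 * (1 + KR * ε) ^ 2 * p * d * ρ₂ ≤ 32 * (p * d) * CS * Cρ * KR * ε :=
    calc 4 * (1 + KR * ε) ^ 2 * p * d * ρ₂ ≤ 16 * (p * d) * ρ₂ := mul_le_mul_of_nonneg_right hM16 hρ₂0
      _ ≤ 16 * (p * d) * (2 * CS * Cρ * KR * ε) := mul_le_mul_of_nonneg_left hρ₂t (by positivity)
      _ = 32 * (p * d) * CS * Cρ * KR * ε := by ring
  have hμρ2 : μ / 2 * ρ₂ ≤ μ * CS * Cρ * KR * ε :=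
    calc μ / 2 * ρ₂ ≤ μ / 2 * (2 * CS * Cρ * KR * ε) := mul_le_mul_of_nonneg_left hρ₂t (by positivity)
      _ = μ * CS * Cρ * KR * ε := by ring
  have hB₂t : B₂ * ε ≤ μ / 2 / 2 := mul_le_half_of_le_div hB₂ (by positivity) ht3
  have hν2 : μ / 4 ≤ μ / 2 * (1 - ρ₂) - (εΔ₂ + 4 * (1 + KR * ε) ^ 2 * p * d * ρ₂) := by
    have : μ * CS * Cρ * KR * ε + 16 * (p * d) * KR * ε + 32 * (p * d) * CS * Cρ * KR * ε = B₂ * ε := by rw [hB₂def]; ring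
    nlinarith [hμρ2, hεΔ₂t, hMρ2, hB₂t, this]
  refine ⟨hν2, ?_⟩
  have hnum : εΔ₂ + 4 * (1 + KR * ε) ^ 2 * p * d * ρ₂ ≤ 8 * (p * d) * KR * (1 + 2 * CS * Cρ) * δ₀ := by
    have h1 : 4 * (1 + KR * ε) ≤ 8 := by linarith
    have hε2 : εΔ₂ ≤ 8 * (p * d) * KR * δ₀ := by
      rw [hεΔ₂]
      calc 4 * (1 + KR * ε) * p * d * (KR * δ₀) = (4 * (1 + KR * ε)) * ((p * d) * (KR * δ₀)) := by ring
        _ ≤ 8 * ((p * d) * (KR * δ₀)) := mul_le_mul_of_nonneg_right h1 (by positivity)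
        _ = 8 * (p * d) * KR * δ₀ := by ring
    have hm2 : 4 * (1 + KR * ε) ^ 2 * p * d * ρ₂ ≤ 16 * (p * d) * ρ₂ := mul_le_mul_of_nonneg_right hM16 hρ₂0
    have e : 16 * (p * d) * ρ₂ = 16 * (p * d) * KR * CS * Cρ * δ₀ := by rw [hρ₂def]; ring
    nlinarith [hε2, hm2, e]
  have hnn : 0 ≤ 2 * (εΔ₂ + 4 * (1 + KR * ε) ^ 2 * p * d * ρ₂) := by positivity
  calc _ ≤ 2 * (εΔ₂ + 4 * (1 + KR * ε) ^ 2 * p * d * ρ₂) / (μ / 4) := div_le_div_of_nonneg_left hnn (by positivity) hν2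
    _ = 8 * (εΔ₂ + 4 * (1 + KR * ε) ^ 2 * p * d * ρ₂) / μ := by rw [div_div_eq_mul_div]; ring
    _ ≤ 8 * (8 * (p * d) * KR * (1 + 2 * CS * Cρ) * δ₀) / μ := by gcongr
    _ = 64 * (p * d) * KR * (1 + 2 * CS * Cρ) / μ * δ₀ := by ring


/-- `K^N − 1 ≤ N(K − 1)K^N` for `K ≥ 1` (the tower's linear majorant). [folklore] -/
private theorem pow_sub_one_le_mul_pow {K : ℝ} (hK : 1 ≤ K) : ∀ N : ℕ, K ^ N - 1 ≤ N * (K - 1) * K ^ N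
  | 0 => by simp
  | N + 1 => by
    have ih := pow_sub_one_le_mul_pow hK N
    have hK0 : 0 ≤ K := by linarith
    have hKN1 : 1 ≤ K ^ (N + 1) := one_le_pow₀ hK
    calc K ^ (N + 1) - 1 = K * (K ^ N - 1) + (K - 1) := by ring
      _ ≤ K * ((N : ℝ) * (K - 1) * K ^ N) + (K - 1) * K ^ (N + 1) :=
          add_le_add (mul_le_mul_of_nonneg_left ih hK0) (le_mul_of_one_le_right (by linarith) hKN1)
      _ = ((N + 1 : ℕ) : ℝ) * (K - 1) * K ^ (N + 1) := by push_cast; ring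

/-- `(1+x)^{D(N+1)}`-type majorants: for `0 ≤ x ≤ 1`, `((1+x)^D)^{N} ≤ 2^{D·N}`. [folklore] -/
private theorem pow_pow_le_two_pow {x : ℝ} (hx0 : 0 ≤ x) (hx1 : x ≤ 1) (D N : ℕ) : ((1 + x) ^ D) ^ N ≤ (2 : ℝ) ^ (D * N) := by
  rw [← pow_mul]
  exact pow_le_pow_left₀ (by positivity) (by linarith) _

variable {d : ℕ} (L : ℕ) [NeZero L] (m : Fin d → ℕ) [∀ i, NeZero (m i)] (n : ℕ)
  {𝔸 : Type*} [NormedRing 𝔸] [NormedAlgebra ℂ 𝔸] [CompleteSpace 𝔸] [NormOneClass 𝔸]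
  {W : Type*} [NormedAddCommGroup W] [InnerProductSpace ℂ W] [FiniteDimensional ℂ W] (φ : W ≃ₗ[ℂ] 𝔸) {c₀ : ℝ} [Fact (0 < c₀)]

/-- **`R_k(U)` IS LIPSCHITZ IN THE BACKGROUND BETWEEN TWO SMALL BACKGROUNDS OF THE FINEST TORUS**: `∃ C_R ε_R > 0` such that for every `U`, `U′`
on `T_{L^{n+1} m}` with `U(b), U′(b) ∈ U1`, `‖U(b) − 1‖, ‖U′(b) − 1‖ ≤ ε ≤ ε_R`, `‖U(b) − U′(b)‖ ≤ δ`, mutually adjoint finest transporters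
(`hRS`, `hRS′`), AND the same three letters for every level average `Ū^j(b) = UlevOf L m (n+1) U j b`, `Ū′^j(b)` (DISPLAYED):
`‖R_k(U)z − R_k(U′)z‖ ≤ C_R·δ·‖z‖` — the gap-of-subspaces remainder of `B9Eq368ProjectionRemainder.norm_projR_sub_projR_le` between
`(Δ^η_{U′}, Q′_k(U′))` and `(Δ^η_U, Q′_k(U))` (remainders `εΔ` by (B)₂ on the finest lattice, `ρ` by the `k`-level `Q′_k` letters and the tower right
inverse), on the modulus of `Δ^η_{U′}` on `N(Q′_k(U′))` transported from the flat tower modulus (`modulus_perturbed`); the constant made linear in `δ`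
by `ε ≤ ε_R` (and `δ ∧ 2ε` in place of `δ`).  Print's `P₁(A)` of (3.76) at a GENERAL `U` and `k` levels, first order, fixed lattice.
[cite: Balaban1985BackgroundPropagators, (3.68) p.403, (3.76) p.405, (3.21)–(3.25) p.394] -/
theorem exists_RofUk_sub_RofUk_linear {η : ℝ} (hη : η ≠ 0) {Mφ Mφ' : ℝ} (hMφ : 0 ≤ Mφ) (hMφ' : 0 ≤ Mφ')
    (hφ : ∀ w, ‖φ w‖ ≤ Mφ * ‖w‖) (hφ' : ∀ X, ‖φ.symm X‖ ≤ Mφ' * ‖X‖) :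
    ∃ CR εR₀ : ℝ, 0 < CR ∧ 0 < εR₀ ∧ ∀ (U U' : Bond d (towerP L m (n + 1)) → 𝔸ˣ) {ε δ : ℝ}, 0 ≤ ε → ε ≤ εR₀ → 0 ≤ δ →
      (∀ b, U b ∈ U1 𝔸) → (∀ b, U' b ∈ U1 𝔸) → (∀ b, ‖(U b : 𝔸) - 1‖ ≤ ε) → (∀ b, ‖(U' b : 𝔸) - 1‖ ≤ ε) →
      (∀ b, ‖(U b : 𝔸) - (U' b : 𝔸)‖ ≤ δ) →
      (∀ (b : Bond d (towerP L m (n + 1))) (v u : W), ⟪adTransportW φ U b v, u⟫_ℂ = ⟪v, adTransportW φ (fun b => (U b)⁻¹) b u⟫_ℂ) →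
      (∀ (b : Bond d (towerP L m (n + 1))) (v u : W), ⟪adTransportW φ U' b v, u⟫_ℂ = ⟪v, adTransportW φ (fun b => (U' b)⁻¹) b u⟫_ℂ) →
      (∀ (j : ℕ) (b : Bond d (towerP L m (j + 1))), UlevOf L m (n + 1) U j b ∈ U1 𝔸) →
      (∀ (j : ℕ) (b : Bond d (towerP L m (j + 1))), UlevOf L m (n + 1) U' j b ∈ U1 𝔸) →
      (∀ (j : ℕ) (b : Bond d (towerP L m (j + 1))), ‖((UlevOf L m (n + 1) U j b : 𝔸ˣ) : 𝔸) - 1‖ ≤ ε) →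
      (∀ (j : ℕ) (b : Bond d (towerP L m (j + 1))), ‖((UlevOf L m (n + 1) U' j b : 𝔸ˣ) : 𝔸) - 1‖ ≤ ε) →
      (∀ (j : ℕ) (b : Bond d (towerP L m (j + 1))),
        ‖((UlevOf L m (n + 1) U j b : 𝔸ˣ) : 𝔸) - ((UlevOf L m (n + 1) U' j b : 𝔸ˣ) : 𝔸)‖ ≤ δ) →
      ∀ z : SiteL2K ℂ d (towerP L m (n + 1)) c₀ W,
        ‖RofUk L m n φ η U z - RofUk L m n φ η U' z‖ ≤ CR * δ * ‖z‖ := by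
  have hc₀ : 0 < c₀ := Fact.out
  have hc : conj ((η : ℂ))⁻¹ = ((η : ℂ))⁻¹ := by rw [map_inv₀, Complex.conj_ofReal]
  obtain ⟨μ, hμ, hmod⟩ := exists_flat_modulus_tower L m n φ (c₀ := c₀) hη
  -- constants (`p = |η|⁻²`, `K_R = 2M_φM_φ′`, `C_ρ` (tower), `C_S` (tower right inverse))
  have hp : (0 : ℝ) ≤ ‖((η : ℂ))⁻¹‖ ^ 2 := sq_nonneg _
  have hdn : (0 : ℝ) ≤ (d : ℝ) := Nat.cast_nonneg d
  obtain ⟨KR, hKRdef⟩ : ∃ KR : ℝ, KR = 2 * Mφ * Mφ' := ⟨_, rfl⟩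
  have hKR : 0 ≤ KR := by rw [hKRdef]; positivity
  obtain ⟨Cρ, hCρdef⟩ : ∃ Cρ : ℝ, Cρ = ((n : ℝ) + 1) * (d * (L - 1) : ℕ) * 2 ^ (d * (L - 1) * (n + 2)) * (Real.sqrt c₀)⁻¹ := ⟨_, rfl⟩
  have hCρ : 0 ≤ Cρ := by rw [hCρdef]; positivity
  obtain ⟨S₀, hS₀all, -, hS₀n'⟩ := exists_QprimeTowerW_rightInverse L m n (𝔸 := 𝔸) (W := W) (c₀ := c₀)
  obtain ⟨CS, hCSdef⟩ : ∃ CS : ℝ, CS = ((L : ℝ) ^ d) ^ (n + 1) * Real.sqrt (c₀ * Fintype.card (TSite d m)) := ⟨_, rfl⟩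
  have hCS : 0 ≤ CS := by rw [hCSdef]; positivity
  obtain ⟨CR, hCRdef⟩ : ∃ CR : ℝ, CR = 64 * (‖((η : ℂ))⁻¹‖ ^ 2 * d) * KR * (1 + 2 * CS * Cρ) / μ + 1 := ⟨_, rfl⟩
  have hCR : 0 < CR := by rw [hCRdef]; positivity
  refine ⟨CR, min (1 / (KR + 1)) (min
    (μ / (2 * (μ * CS + 6 * (‖((η : ℂ))⁻¹‖ ^ 2 * d) * KR + 16 * (‖((η : ℂ))⁻¹‖ ^ 2 * d) * CS) + 1) / (1 + Cρ * KR))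
    (μ / 2 / (2 * (μ * CS * Cρ * KR + 16 * (‖((η : ℂ))⁻¹‖ ^ 2 * d) * KR + 32 * (‖((η : ℂ))⁻¹‖ ^ 2 * d) * CS * Cρ * KR) + 1))),
    hCR, by positivity, ?_⟩
  intro U U' ε δ hε hεR₀ hδ hUb hU'b hUε hU'ε hUU' hRS hRS' hLb hL'b hLε hL'ε hLL' z
  have ht1 : ε ≤ 1 / (KR + 1) := hεR₀.trans (min_le_left _ _)
  have ht2' := hεR₀.trans ((min_le_right _ _).trans (min_le_left _ _))
  have ht2 : (1 + Cρ * KR) * ε ≤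
      μ / (2 * (μ * CS + 6 * (‖((η : ℂ))⁻¹‖ ^ 2 * d) * KR + 16 * (‖((η : ℂ))⁻¹‖ ^ 2 * d) * CS) + 1) := by
    have := mul_le_mul_of_nonneg_left ht2' (by positivity : (0 : ℝ) ≤ 1 + Cρ * KR)
    rwa [mul_div_cancel₀ _ (by positivity : (1 + Cρ * KR) ≠ 0)] at this
  have ht3 := hεR₀.trans ((min_le_right _ _).trans (min_le_right _ _))
  -- STEP 1 budget (pure arithmetic)
  obtain ⟨hKε1, hM, hν1⟩ := budget₁ hμ hp hdn hKR hCρ hCS hε ht1 ht2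
  -- the effective distance `δ₀ = δ ∧ 2ε`
  obtain ⟨δ₀, hδ₀def⟩ : ∃ δ₀ : ℝ, δ₀ = min δ (2 * ε) := ⟨_, rfl⟩
  have hδ₀ : 0 ≤ δ₀ := by rw [hδ₀def]; exact le_min hδ (by positivity)
  have hδ₀δ : δ₀ ≤ δ := by rw [hδ₀def]; exact min_le_left _ _
  have hδ₀ε : δ₀ ≤ 2 * ε := by rw [hδ₀def]; exact min_le_right _ _
  have hUU'₀ : ∀ b, ‖(U b : 𝔸) - (U' b : 𝔸)‖ ≤ δ₀ := fun b => by
    rw [hδ₀def]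
    refine le_min (hUU' b) ?_
    calc ‖(U b : 𝔸) - (U' b : 𝔸)‖ = ‖((U b : 𝔸) - 1) - ((U' b : 𝔸) - 1)‖ := by rw [sub_sub_sub_cancel_right]
      _ ≤ ‖(U b : 𝔸) - 1‖ + ‖(U' b : 𝔸) - 1‖ := norm_sub_le _ _
      _ ≤ 2 * ε := by linarith [hUε b, hU'ε b]
  have hLL'₀ : ∀ (j : ℕ) (b : Bond d (towerP L m (j + 1))),
      ‖((UlevOf L m (n + 1) U' j b : 𝔸ˣ) : 𝔸) - ((UlevOf L m (n + 1) U j b : 𝔸ˣ) : 𝔸)‖ ≤ δ₀ := fun j b => by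
    rw [hδ₀def, norm_sub_rev]
    refine le_min (hLL' j b) ?_
    calc ‖((UlevOf L m (n + 1) U j b : 𝔸ˣ) : 𝔸) - ((UlevOf L m (n + 1) U' j b : 𝔸ˣ) : 𝔸)‖
        = ‖(((UlevOf L m (n + 1) U j b : 𝔸ˣ) : 𝔸) - 1) - (((UlevOf L m (n + 1) U' j b : 𝔸ˣ) : 𝔸) - 1)‖ := by rw [sub_sub_sub_cancel_right]
      _ ≤ ‖((UlevOf L m (n + 1) U j b : 𝔸ˣ) : 𝔸) - 1‖ + ‖((UlevOf L m (n + 1) U' j b : 𝔸ˣ) : 𝔸) - 1‖ := norm_sub_le _ _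
      _ ≤ 2 * ε := by linarith [hLε j b, hL'ε j b]
  -- STEP 2 budget (pure arithmetic)
  obtain ⟨hεΔ₂0, h64, hν2, hgap⟩ := budget₂ (εΔ₂ := 4 * (1 + KR * ε) * ‖((η : ℂ))⁻¹‖ ^ 2 * d * (KR * δ₀))
    hμ hp hdn hKR hCρ hCS hε hδ₀ hδ₀ε hKε1 rfl ht3
  have hν : 0 < μ / 2 * (1 - CS * (Cρ * (KR * δ₀))) -
      (4 * (1 + KR * ε) * ‖((η : ℂ))⁻¹‖ ^ 2 * d * (KR * δ₀) + 4 * (1 + KR * ε) ^ 2 * ‖((η : ℂ))⁻¹‖ ^ 2 * d * (CS * (Cρ * (KR * δ₀)))) :=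
    lt_of_lt_of_le (by positivity) hν2
  -- the finest transporters: `K_Rε`-close to the identity, `K_Rδ₀`-close to each other
  have hεR : 0 ≤ KR * ε := mul_nonneg hKR hε
  have hδR : 0 ≤ KR * δ₀ := mul_nonneg hKR hδ₀
  have hR : ∀ (b : Bond d (towerP L m (n + 1))) (w : W), ‖adTransportW φ U b w - w‖ ≤ KR * ε * ‖w‖ := fun b w => by
    have h := norm_adTransportW_sub_le φ hφ hφ' hMφ' U b (hUb b) (hUε b) w
    rw [hKRdef]; linarith
  have hR' : ∀ (b : Bond d (towerP L m (n + 1))) (w : W), ‖adTransportW φ U' b w - w‖ ≤ KR * ε * ‖w‖ := fun b w => by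
    have h := norm_adTransportW_sub_le φ hφ hφ' hMφ' U' b (hU'b b) (hU'ε b) w
    rw [hKRdef]; linarith
  have hRR' : ∀ (b : Bond d (towerP L m (n + 1))) (w : W), ‖adTransportW φ U b w - adTransportW φ U' b w‖ ≤ KR * δ₀ * ‖w‖ := fun b w => by
    have h := norm_adTransportW_sub_adTransportW_le L (towerP L m n) φ hφ hφ' hMφ' U U' b (hUb b) (hU'b b) (hUU'₀ b) w
    rw [hKRdef]; exact h
  have hR₁ : ∀ (b : Bond d (towerP L m (n + 1))) (w : W), adTransportW φ (fun _ : Bond d (towerP L m (n + 1)) => (1 : 𝔸ˣ)) b w = w :=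
    adTransportW_one_apply L (towerP L m n) φ
  have hS₁ : ∀ (b : Bond d (towerP L m (n + 1))) (w : W), adTransportW φ (fun _ : Bond d (towerP L m (n + 1)) => (1 : 𝔸ˣ)⁻¹) b w = w :=
    adTransportW_one_inv_apply L (towerP L m n) φ
  have hR₁ε : ∀ (b : Bond d (towerP L m (n + 1))) (w : W),
      ‖adTransportW φ (fun _ : Bond d (towerP L m (n + 1)) => (1 : 𝔸ˣ)) b w - w‖ ≤ KR * ε * ‖w‖ :=
    fun b w => by rw [hR₁, sub_self, norm_zero]; exact mul_nonneg hεR (norm_nonneg w)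
  have hRS₁ := hRS_one L (towerP L m n) φ (𝔸 := 𝔸)
  -- the tower right inverse (right inverse of EVERY `Q′_k(V)`)
  have hS₀ : ∀ (V : Bond d (towerP L m (n + 1)) → 𝔸ˣ) (f : TSite d m → W), QprimeTowerW L m n φ V (c₀ := c₀) (S₀ f) = f :=
    fun V f => hS₀all φ V f
  have hS₀n : ∀ ω : TSite d m → W, ‖S₀ ω‖ ≤ CS * ‖ω‖ := fun ω => by rw [hCSdef]; exact hS₀n' ω
  -- the `k`-level `Q′`-letters: flat vs `U′` and `U′` vs `U`, read through `C_ρ`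
  have hs0 : 0 < Real.sqrt c₀ := Real.sqrt_pos.2 hc₀
  have hKε2 : (1 + KR * ε) ^ (d * (L - 1)) ≤ (2 : ℝ) ^ (d * (L - 1)) := pow_le_pow_left₀ (by linarith) (by linarith) _
  have hK1 : (1 : ℝ) ≤ (1 + KR * ε) ^ (d * (L - 1)) := one_le_pow₀ (by linarith)
  -- (i) `K^{n+1} − 1 ≤ C_ρ√c₀·(K_Rε)`
  have hmaj1 : (((1 + KR * ε) ^ (d * (L - 1))) ^ (n + 1) - 1) * (Real.sqrt c₀)⁻¹ ≤ Cρ * (KR * ε) := by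
    rw [hCρdef]
    have h1 := pow_sub_one_le_mul_pow hK1 (n + 1)
    have h2 : (1 + KR * ε) ^ (d * (L - 1)) - 1 ≤ (d * (L - 1) : ℕ) * (KR * ε) * (1 + KR * ε) ^ (d * (L - 1)) :=
      B9Eq319QprimeLipschitz.rho_le L (d := d) hεR
    have h3 : ((1 + KR * ε) ^ (d * (L - 1))) ^ (n + 1) * (1 + KR * ε) ^ (d * (L - 1)) ≤ (2 : ℝ) ^ (d * (L - 1) * (n + 2)) := by
      rw [← pow_succ, ← pow_mul]
      exact pow_le_pow_left₀ (by positivity) (by linarith) _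
    have h4 : ((1 + KR * ε) ^ (d * (L - 1))) ^ (n + 1) - 1 ≤
        ((n : ℝ) + 1) * (d * (L - 1) : ℕ) * 2 ^ (d * (L - 1) * (n + 2)) * (KR * ε) := by
      have hA : 0 ≤ ((n : ℝ) + 1) * ((d * (L - 1) : ℕ) * (KR * ε)) := by positivity
      calc ((1 + KR * ε) ^ (d * (L - 1))) ^ (n + 1) - 1
          ≤ ((n + 1 : ℕ) : ℝ) * ((1 + KR * ε) ^ (d * (L - 1)) - 1) * ((1 + KR * ε) ^ (d * (L - 1))) ^ (n + 1) := h1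
        _ ≤ ((n + 1 : ℕ) : ℝ) * ((d * (L - 1) : ℕ) * (KR * ε) * (1 + KR * ε) ^ (d * (L - 1))) * ((1 + KR * ε) ^ (d * (L - 1))) ^ (n + 1) := by
            gcongr
        _ = ((n : ℝ) + 1) * ((d * (L - 1) : ℕ) * (KR * ε)) * (((1 + KR * ε) ^ (d * (L - 1))) ^ (n + 1) * (1 + KR * ε) ^ (d * (L - 1))) := by
            push_cast; ring
        _ ≤ ((n : ℝ) + 1) * ((d * (L - 1) : ℕ) * (KR * ε)) * (2 : ℝ) ^ (d * (L - 1) * (n + 2)) := mul_le_mul_of_nonneg_left h3 hA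
        _ = ((n : ℝ) + 1) * (d * (L - 1) : ℕ) * 2 ^ (d * (L - 1) * (n + 2)) * (KR * ε) := by ring
    have hinv : 0 ≤ (Real.sqrt c₀)⁻¹ := by positivity
    calc (((1 + KR * ε) ^ (d * (L - 1))) ^ (n + 1) - 1) * (Real.sqrt c₀)⁻¹
        ≤ (((n : ℝ) + 1) * (d * (L - 1) : ℕ) * 2 ^ (d * (L - 1) * (n + 2)) * (KR * ε)) * (Real.sqrt c₀)⁻¹ :=
          mul_le_mul_of_nonneg_right h4 hinv
      _ = ((n : ℝ) + 1) * (d * (L - 1) : ℕ) * 2 ^ (d * (L - 1) * (n + 2)) * (Real.sqrt c₀)⁻¹ * (KR * ε) := by ring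
  -- (ii) `(n+1)K^{n+1}·d(L−1)(K_Rδ₀)K ≤ C_ρ√c₀·(K_Rδ₀)`
  have hmaj2 : ((n : ℝ) + 1) * ((1 + KR * ε) ^ (d * (L - 1))) ^ (n + 1) *
      (((d * (L - 1) : ℕ) : ℝ) * (KR * δ₀) * (1 + KR * ε) ^ (d * (L - 1))) * (Real.sqrt c₀)⁻¹ ≤ Cρ * (KR * δ₀) := by
    rw [hCρdef]
    have h3 : ((1 + KR * ε) ^ (d * (L - 1))) ^ (n + 1) * (1 + KR * ε) ^ (d * (L - 1)) ≤ (2 : ℝ) ^ (d * (L - 1) * (n + 2)) := by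
      rw [← pow_succ, ← pow_mul]
      exact pow_le_pow_left₀ (by positivity) (by linarith) _
    have hA : 0 ≤ ((n : ℝ) + 1) * ((d * (L - 1) : ℕ) * (KR * δ₀)) * (Real.sqrt c₀)⁻¹ := by positivity
    calc ((n : ℝ) + 1) * ((1 + KR * ε) ^ (d * (L - 1))) ^ (n + 1) *
        (((d * (L - 1) : ℕ) : ℝ) * (KR * δ₀) * (1 + KR * ε) ^ (d * (L - 1))) * (Real.sqrt c₀)⁻¹
        = ((n : ℝ) + 1) * ((d * (L - 1) : ℕ) * (KR * δ₀)) * (Real.sqrt c₀)⁻¹ *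
            (((1 + KR * ε) ^ (d * (L - 1))) ^ (n + 1) * (1 + KR * ε) ^ (d * (L - 1))) := by ring
      _ ≤ ((n : ℝ) + 1) * ((d * (L - 1) : ℕ) * (KR * δ₀)) * (Real.sqrt c₀)⁻¹ * (2 : ℝ) ^ (d * (L - 1) * (n + 2)) :=
          mul_le_mul_of_nonneg_left h3 hA
      _ = ((n : ℝ) + 1) * (d * (L - 1) : ℕ) * 2 ^ (d * (L - 1) * (n + 2)) * (Real.sqrt c₀)⁻¹ * (KR * δ₀) := by ring
  -- the level transporters' letters
  have hRl' : ∀ (j : ℕ) (b : Bond d (towerP L m (j + 1))) (v : W),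
      ‖adTransportW φ (UlevOf L m (n + 1) U' j) b v - v‖ ≤ 2 * Mφ * Mφ' * ε * ‖v‖ :=
    fun j b v => norm_adTransportW_sub_le φ hφ hφ' hMφ' _ b (hL'b j b) (hL'ε j b) v
  have hQ'1 : ∀ l : SiteL2K ℂ d (towerP L m (n + 1)) c₀ W,
      ‖QprimeTowerW L m n φ U' l - QprimeTowerW L m n φ (fun _ : Bond d (towerP L m (n + 1)) => (1 : 𝔸ˣ)) l‖ ≤ Cρ * (KR * ε) * ‖l‖ :=
    fun l => by
    have h := norm_QprimeTowerW_sub_flat_le L m n φ hMφ hMφ' hφ hφ' U' hε hL'ε hL'b l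
    have e : 2 * Mφ * Mφ' * ε = KR * ε := by rw [hKRdef]
    rw [e] at h
    refine h.trans ?_
    rw [← mul_assoc]
    exact mul_le_mul_of_nonneg_right hmaj1 (norm_nonneg _)
  have hQ'2 : ∀ l : SiteL2K ℂ d (towerP L m (n + 1)) c₀ W,
      ‖QprimeTowerW L m n φ U' l - QprimeTowerW L m n φ U l‖ ≤ Cρ * (KR * δ₀) * ‖l‖ := fun l => by
    have h := norm_QprimeTowerW_sub_QprimeTowerW_le L m n φ hMφ hMφ' hφ hφ' U' U hε hL'ε hLε hL'b hLb hδ₀ hLL'₀ l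
    have e1 : 2 * Mφ * Mφ' * ε = KR * ε := by rw [hKRdef]
    have e2 : 2 * Mφ * Mφ' * δ₀ = KR * δ₀ := by rw [hKRdef]
    rw [e1, e2] at h
    refine h.trans ?_
    have := mul_le_mul_of_nonneg_right hmaj2 (norm_nonneg l)
    calc ((n : ℝ) + 1) * ((1 + KR * ε) ^ (d * (L - 1))) ^ (n + 1) *
          (((d * (L - 1) : ℕ) : ℝ) * (KR * δ₀) * (1 + KR * ε) ^ (d * (L - 1))) * ((Real.sqrt c₀)⁻¹ * ‖l‖)
        = ((n : ℝ) + 1) * ((1 + KR * ε) ^ (d * (L - 1))) ^ (n + 1) *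
          (((d * (L - 1) : ℕ) : ℝ) * (KR * δ₀) * (1 + KR * ε) ^ (d * (L - 1))) * (Real.sqrt c₀)⁻¹ * ‖l‖ := by ring
      _ ≤ Cρ * (KR * δ₀) * ‖l‖ := this
  have hρ₁ : ∀ l : SiteL2K ℂ d (towerP L m (n + 1)) c₀ W,
      ‖S₀ (QprimeTowerW L m n φ (fun _ : Bond d (towerP L m (n + 1)) => (1 : 𝔸ˣ)) l - QprimeTowerW L m n φ U' l)‖ ≤
        CS * (Cρ * (KR * ε)) * ‖l‖ := fun l => by
    have h : S₀ (QprimeTowerW L m n φ (fun _ : Bond d (towerP L m (n + 1)) => (1 : 𝔸ˣ)) l - QprimeTowerW L m n φ U' l) =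
        -S₀ (QprimeTowerW L m n φ U' l - QprimeTowerW L m n φ (fun _ : Bond d (towerP L m (n + 1)) => (1 : 𝔸ˣ)) l) := by
      rw [← map_neg, neg_sub]
    rw [h, norm_neg]
    refine (hS₀n _).trans ?_
    calc CS * ‖QprimeTowerW L m n φ U' l - QprimeTowerW L m n φ (fun _ : Bond d (towerP L m (n + 1)) => (1 : 𝔸ˣ)) l‖
        ≤ CS * (Cρ * (KR * ε) * ‖l‖) := mul_le_mul_of_nonneg_left (hQ'1 l) hCS
      _ = CS * (Cρ * (KR * ε)) * ‖l‖ := by ring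
  have hρ₂a : ∀ l : SiteL2K ℂ d (towerP L m (n + 1)) c₀ W,
      ‖S₀ (QprimeTowerW L m n φ U l - QprimeTowerW L m n φ U' l)‖ ≤ CS * (Cρ * (KR * δ₀)) * ‖l‖ := fun l => by
    have h : S₀ (QprimeTowerW L m n φ U l - QprimeTowerW L m n φ U' l) = -S₀ (QprimeTowerW L m n φ U' l - QprimeTowerW L m n φ U l) := by
      rw [← map_neg, neg_sub]
    rw [h, norm_neg]
    refine (hS₀n _).trans ?_
    calc CS * ‖QprimeTowerW L m n φ U' l - QprimeTowerW L m n φ U l‖ ≤ CS * (Cρ * (KR * δ₀) * ‖l‖) :=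
          mul_le_mul_of_nonneg_left (hQ'2 l) hCS
      _ = CS * (Cρ * (KR * δ₀)) * ‖l‖ := by ring
  have hρ₂b : ∀ l : SiteL2K ℂ d (towerP L m (n + 1)) c₀ W,
      ‖S₀ (QprimeTowerW L m n φ U' l - QprimeTowerW L m n φ U l)‖ ≤ CS * (Cρ * (KR * δ₀)) * ‖l‖ :=
    fun l => (hS₀n _).trans (by
      calc CS * ‖QprimeTowerW L m n φ U' l - QprimeTowerW L m n φ U l‖ ≤ CS * (Cρ * (KR * δ₀) * ‖l‖) :=
            mul_le_mul_of_nonneg_left (hQ'2 l) hCS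
        _ = CS * (Cρ * (KR * δ₀)) * ‖l‖ := by ring)
  -- STEP 1: the modulus of `Δ_{U′}` on `N(Q′_k(U′))` is at least `μ∕2`
  have hinj' : ∀ l : SiteL2K ℂ d (towerP L m (n + 1)) c₀ W, QprimeTowerW L m n φ U' (c₀ := c₀) l = 0 →
      μ / 2 * ‖l‖ ≤ ‖covLaplaceSiteK ((η : ℂ))⁻¹ (adTransportW φ U') (adTransportW φ fun b => (U' b)⁻¹) l‖ := fun l hl => by
    have h := modulus_perturbed _ _ _ _ S₀ (hS₀ _) hμ hM hmod (norm_covLaplaceSiteK_le _ hc hεR hR₁ε hRS₁)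
      (norm_covLaplaceSiteK_sub_le _ hc hεR hR' hR₁ hRS' hS₁) hρ₁ l hl
    exact (mul_le_mul_of_nonneg_right hν1 (norm_nonneg _)).trans h
  -- STEP 2: the gap of subspaces between `(Δ_{U′}, Q′_k(U′))` and `(Δ_U, Q′_k(U))`
  have hΔ₂ : ∀ l : SiteL2K ℂ d (towerP L m (n + 1)) c₀ W,
      ‖covLaplaceSiteK ((η : ℂ))⁻¹ (adTransportW φ U) (adTransportW φ fun b => (U b)⁻¹) l -
        covLaplaceSiteK ((η : ℂ))⁻¹ (adTransportW φ U') (adTransportW φ fun b => (U' b)⁻¹) l‖ ≤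
        4 * (1 + KR * ε) * ‖((η : ℂ))⁻¹‖ ^ 2 * d * (KR * δ₀) * ‖l‖ := fun l =>
    norm_covLaplaceSiteK_sub_le₂ _ hc hεR hδR hR hR' hRR' hRS hRS' l
  have hRdiff := norm_projR_sub_projR_le _ _ _ _ S₀ S₀ (hS₀ _) (hS₀ _) (half_pos hμ) hM hεΔ₂0 (by positivity) hinj'
      (norm_covLaplaceSiteK_le _ hc hεR hR' hRS') (norm_covLaplaceSiteK_le _ hc hεR hR hRS) hΔ₂ hρ₂a hρ₂b hν z
  rw [norm_sub_rev]
  unfold RofUk RLatticeK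
  refine hRdiff.trans (mul_le_mul_of_nonneg_right (hgap.trans ?_) (norm_nonneg _))
  calc 64 * (‖((η : ℂ))⁻¹‖ ^ 2 * d) * KR * (1 + 2 * CS * Cρ) / μ * δ₀ ≤ 64 * (‖((η : ℂ))⁻¹‖ ^ 2 * d) * KR * (1 + 2 * CS * Cρ) / μ * δ :=
        mul_le_mul_of_nonneg_left hδ₀δ h64
    _ ≤ 64 * (‖((η : ℂ))⁻¹‖ ^ 2 * d) * KR * (1 + 2 * CS * Cρ) / μ * δ + 1 * δ := le_add_of_nonneg_right (by rw [one_mul]; exact hδ)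
    _ = CR * δ := by rw [hCRdef]; ring

end Literature.MathematicalPhysics.QuantumFieldTheory.Balaban1983to89.B9Eq368RLipschitzTowerTwoBackgrounds

end
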